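import Summits.ResolutionOfSingularities.ResolutionOfSingularities.Theorems.EquisingularLiftEquisingularLiftNatLargeCharSpreadCentres
import Summits.ResolutionOfSingularities.ResolutionOfSingularities.Theorems.EquisingularLiftEquisingularLiftNatDescWordBaseChange
import Summits.ResolutionOfSingularities.ResolutionOfSingularities.Theorems.EquisingularLiftEquisingularLiftNatLargeCharFibreTokens
import Summits.ResolutionOfSingularities.ResolutionOfSingularities.Theorems.EquisingularLiftEquisingularLiftNatLargeCharFibreStrictTransformSat
import Summits.ResolutionOfSingularities.ResolutionOfSingularities.Theorems.EquisingularLiftEquisingularLiftNatLargeCharSpreadFlat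
import Summits.ResolutionOfSingularities.ResolutionOfSingularities.Theorems.EquisingularLiftEquisingularLiftNatLargeCharSpreadInclusion
import Summits.ResolutionOfSingularities.ResolutionOfSingularities.Theorems.EquisingularLiftEquisingularLiftNatLargeCharGenericThread
import Summits.ResolutionOfSingularities.ResolutionOfSingularities.Theorems.EquisingularLiftEquisingularLiftNatNoseSectionStepTools
import Literature.AlgebraicGeometry.Resolution.MarkedIdealsEtale
import Literature.AlgebraicGeometry.Resolution.SmoothOfRegularPerfectField
import Literature.AlgebraicGeometry.Resolution.StrictTransformSupport
import Mathlib.FieldTheory.Perfect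
import HarnessLib

/-!
# EL♮(3) / EL♮(n), RUNG LC «large characteristic» — brick (B5): THE FIBRE WORD — `DescTransformOK` (with empty position target) on EVERY fibre over
# every base `A → B` inverting some `a ≠ 0`, from the K-side word of an INTEGRAL running transform

leafhand-res-equisingularlift-3 g0 (prover, 2026-08-31; one-generation line-first hand on stmt-ResolutionOfSingularities-20148 / -20038 /
-15660, cell `pub/decomp-res`).  Crux `EquisingularLiftNatThree` (`stmt-…-20148`; uniform in `n`, so also `stmt-…-20038`), line W4.5(b), RUNG LC
(idea-2 g32 `Cruxes/EquisingularLiftNatThree/LARGE-CHAR-RUNG-idea2.md` v1.6 §(B3′) (f1)–(f4), §(B5′)).  THE RECURSION assembling this hand's bricks: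
✓ `exists_forall_comap_le_comap` + ✓ `le_of_support_subset_of_smooth` + ✓ `descTransformOK_E1_of_le` (E1), ✓ `exists_forall_flat_trace_comap` +
✓ `comap_strictTransformIdeal_of_flat_trace` / `support_comap_strictTransformIdeal_of_flat_trace` (LC-FIB: the k-side running set is the fibre of the
B-side strict-transform ideal), ✓ `exists_forall_mem_smoothLocus_of_smooth_comap` + ✓ `smooth_subschemeι_comap_of_forall_mem_smoothLocus` +
✓ `descTransformOK_nil_of_smooth` (END), and on the K-side the generic-point thread ✓ `not_subset_support_of_gen` / ✓ `gen_closure_preimage_diff_of_isBlowup`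
+ ✓ `isIntegral_subscheme_strictTransformIdeal` (the strict transforms of the INTEGRAL running transform stay integral, so the regular REDUCED structure of
the K-side END token is the last transform itself, smooth in characteristic zero — ✓ `smooth_of_isRegular_of_perfectField`).  DEF-FREE:

* ★★ `CentreSeq.exists_forall_descTransformOK_comap` — `A` a Noetherian domain with fraction field `K` of characteristic `0`, `q : X → Spec A` of finite
  type with generic fibre `j_K` (any cartesian square), `s : CentreSeq X`, a running ideal `𝓣` with `V(j_K^*𝓣)` INTEGRAL whose generic points map to
  generic points of `Y₀,K` under `σ_K`, and the K-side word: `DescCentresSmoothOver (s.comap j_K) q_K` and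
  `DescTransformOK (s.comap j_K) σ_K Y₀,K (supp j_K^*𝓣)`.  THEN `∃ a ≠ 0` such that for every NOETHERIAN FLAT `A`-algebra `B ∋ a⁻¹`, every cartesian
  `X_B = X ×_A Spec B` on which the induced word has `B`-flat exceptional divisors (free over a regular base, ✓ `…exceptionalFlatOver_of_descCentresSmoothOver`),
  every field-valued point `Spec k → Spec B` with fibre square `X_k = X_B ×_B Spec k`, and every `σ_k`:
  `DescTransformOK ((s.comap ι_B).comap j) σ_k ∅ (supp (j^* ι_B^* 𝓣))` — the k-fibre clause of ✓ `DescDoorAt` with the POSITION TARGET EMPTIED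
  (`{x | ¬ IsGenericPoint x ∅} = everything`): (E1), the tail on the honest strict transform `closure (π_k⁻¹ (Y ∖ supp C_k))`, and (END) are all GENUINE.

HONEST RESIDUAL of `hspread` after this file: (i) upgrading the position target `∅ ↦ Set.range ι` = the position token (f3) at every stage, which by
✓ `image_support_subset_not_isGenericPoint_of_inv` + ✓ `inv_closure_preimage_diff_of_isBlowup` costs exactly «`¬ supp (j^*ι_B^*𝓣ᵢ) ⊆ supp (j^*ι_B^*Cᵢ)`
on the fibres» (fibre dimension: a `k`-fibre of the `B`-smooth centre, of relative dimension `≤ n − 2`, cannot contain the `(n−1)`-dimensional strict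
transform of the integral hypersurface `H_θ`) — a threaded re-run of this recursion with that input; (ii) the instantiation on `ℙⁿ`: `𝓣 := 𝓗_A` the universal
hypersurface restricted to `A = ℤ[c]/𝔮`, `X_B = ℙⁿ_B` (✓ `isPullback_projMap'`), `B = A[1/(a a₀)]` smooth over `ℤ` (✓ (B4)), ✓ `descDoorAt_of_smoothCentres`,
✓ `descDoorAt_of_ringHom`, the N:=1 glue, (c3) the tying `Cut`.  EL♮(3) NOT proved; EL♮ NOT proved; resolution of singularities in positive characteristic
NOT proved; nothing of [Hironaka2017] (a candidate under adjudication) is asserted or used.  [OURS · EGA IV₃ §8–9 recursion over tree lemmas · standard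
axioms · DEF-FREE · `--supports stmt-ResolutionOfSingularities-20148 --as helper`, counted 0 · AI-written, weaker than expert review.]
[cite: Grothendieck1966, EGA IV₃ §8–§9] [cite: GortzWedhorn2020, (13.19)] [cite: StacksProject, Tags 056P, 080E, 0805] (method; index only)
-/

set_option linter.dupNamespace false -- mandated namespace `Summit.<Summit>.<Problem>` of this single-conjunct summit

noncomputable section

open CategoryTheory CategoryTheory.Limits AlgebraicGeometry TopologicalSpace Topology PrimeSpectrum
open Literature.AlgebraicGeometry.Resolution
open AlgebraicGeometry.Scheme.IdealSheafData

namespace Summit.ResolutionOfSingularities.ResolutionOfSingularities.Cruxes.EquisingularLiftNat.Sections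

section FibreWord

variable {A : Type} [CommRing A] [IsDomain A] [IsNoetherianRing A] (K : Type) [Field K] [CharZero K] [Algebra A K] [IsFractionRing A K]

/-- The image of the centre always misses the generic points of the EMPTY target. [folklore] -/
theorem image_subset_not_isGenericPoint_empty {P X : Scheme.{0}} (σ : X ⟶ P) (S : Set X) :
    σ '' S ⊆ {x | ¬ IsGenericPoint x (∅ : Set P)} :=
  fun _ _ h => h.mem

/-- The support of the closed subscheme of an INTEGRAL `V(I)` is irreducible. [folklore] -/
theorem isIrreducible_support_of_isIntegral {X : Scheme.{0}} (I : X.IdealSheafData) [IsIntegral I.subscheme] :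
    IsIrreducible ((I.support : Set X)) := by
  rw [← range_subschemeι, ← Set.image_univ]
  exact (IrreducibleSpace.isIrreducible_univ _).image _ I.subschemeι.continuous.continuousOn

/-- ★★ **(B5) THE FIBRE WORD** — see the module docstring.  Induction on `s`.  `nil`: the K-side END token is the regularity of the reduced structure on
`supp j_K^*𝓣`, which IS `V(j_K^*𝓣)` (integral ⇒ reduced, ✓ `eq_vanishingIdeal_support_of_isReduced_subscheme`), hence smooth over `K`
(✓ `smooth_of_isRegular_of_perfectField`); spread (✓ `exists_forall_mem_smoothLocus_of_smooth_comap`), package over `B` (✓ `smooth_subschemeι_comap_of_forall_mem_smoothLocus`)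
and read END on the fibre (✓ `descTransformOK_nil_of_smooth`).  `cons C rest`: K-side — `𝓣_K ≤ C_K` (✓ `le_of_support_subset_of_smooth`), no-swallow
(✓ `not_subset_support_of_gen`), integrality and GEN of the next transform (✓ `isIntegral_subscheme_strictTransformIdeal`, ✓ `gen_closure_preimage_diff_of_isBlowup`,
the next running ideal being `strictTransformIdeal π C 𝓣` pulled back along the FLAT `Bl(j_K)`, ✓ `comap_strictTransformIdeal_of_flat`,
✓ `support_strictTransformIdeal_eq_closure`); spread `𝓣 ≤ C` (✓ `exists_forall_comap_le_comap`), the flatness of the trace `E ∩ V(𝓣')` (✓ `exists_forall_flat_trace_comap`)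
and the tail (induction); fibre side — (E1) ✓ `descTransformOK_E1_of_le`, empty position target, and the tail on `supp (j'^* Bl(ι_B)^* 𝓣') =
closure (π_k⁻¹ (Y ∖ supp C_k))` by ✓ `support_comap_strictTransformIdeal_of_flat_trace` (the fibre square of the blown-up stage by the `B`-flat exceptional
divisor, ✓ `blowup.isPullback_comapMap_specMap_of_flat_exceptional`).
[cite: Grothendieck1966, EGA IV₃ §8–§9] [cite: GortzWedhorn2020, (13.19)] [OURS · L1 W4.5b · RUNG LC (B5); EL♮(3) NOT proved] -/
theorem CentreSeq.exists_forall_descTransformOK_comap :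
    ∀ {X XK : Scheme.{0}} [IsLocallyNoetherian XK] (s : CentreSeq X) (q : X ⟶ Spec (.of A))
      [LocallyOfFiniteType q] [QuasiCompact q] (jK : XK ⟶ X) (qK : XK ⟶ Spec (.of K)) [LocallyOfFiniteType qK],
      IsPullback jK qK q (specOfAlgebra A K) → ∀ (T : X.IdealSheafData) {PK : Scheme.{0}} (σK : XK ⟶ PK) (Y₀K : Set PK),
      DescCentresSmoothOver (s.comap jK) qK →
      DescTransformOK (s.comap jK) σK Y₀K (((T.comap jK).support : Set XK)) →
      IsIntegral (T.comap jK).subscheme →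
      (∀ y, IsGenericPoint y (((T.comap jK).support : Set XK)) → IsGenericPoint (σK y) Y₀K) →
      ∃ a : A, a ≠ 0 ∧ ∀ (B : Type) [CommRing B] [IsNoetherianRing B] [Algebra A B] [Module.Flat A B], IsUnit (algebraMap A B a) →
        ∀ {XB : Scheme.{0}} (ιB : XB ⟶ X) (qB : XB ⟶ Spec (.of B)), IsPullback ιB qB q (specOfAlgebra A B) →
          (s.comap ιB).ExceptionalFlatOver qB →
          ∀ (k : Type) [Field k] [Algebra B k] {Xk : Scheme.{0}} (j : Xk ⟶ XB) (tk : Xk ⟶ Spec (.of k)),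
            IsPullback j tk qB (specOfAlgebra B k) →
            ∀ {Pk : Scheme.{0}} (σk : Xk ⟶ Pk),
              DescTransformOK ((s.comap ιB).comap j) σk (∅ : Set Pk) ((((T.comap ιB).comap j).support : Set Xk))
  | X, XK, _, .nil _, q, _, _, jK, qK, _, HK, T, PK, σK, Y₀K, _, hT, hint, _ => by
    haveI : IsLocallyNoetherian X := LocallyOfFiniteType.isLocallyNoetherian q
    haveI := hint
    haveI : PerfectField K := PerfectField.ofCharZero
    -- the K-side END token is the regularity of `V(j_K^*𝓣)` itself (integral ⇒ reduced)
    rw [CentreSeq.comap_nil] at hT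
    have hT' : Scheme.IsRegular (vanishingIdeal (⟨closure (((T.comap jK).support : Set XK)), isClosed_closure⟩ : Closeds XK)).subscheme := hT
    have hcl : (⟨closure (((T.comap jK).support : Set XK)), isClosed_closure⟩ : Closeds XK) = (T.comap jK).support :=
      Closeds.ext (T.comap jK).support.isClosed.closure_eq
    rw [hcl, eq_vanishingIdeal_support_of_isReduced_subscheme (T.comap jK)] at hT'
    -- hence smooth over `K`, and smoothness spreads
    have hsmK : Smooth ((T.comap jK).subschemeι ≫ qK) := smooth_of_isRegular_of_perfectField _ hT'
    obtain ⟨a, ha, h₁⟩ := exists_forall_mem_smoothLocus_of_smooth_comap K q HK T hsmK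
    refine ⟨a, ha, fun B _ _ _ _ hunit XB ιB qB HX _ k _ _ Xk j tk HXk Pk σk => ?_⟩
    haveI : Smooth ((T.comap ιB).subschemeι ≫ qB) := smooth_subschemeι_comap_of_forall_mem_smoothLocus q T h₁ B hunit HX
    rw [CentreSeq.comap_nil, CentreSeq.comap_nil]
    exact descTransformOK_nil_of_smooth k qB HXk (T.comap ιB) σk ∅ _ rfl
  | X, XK, _, .cons C rest, q, _, _, jK, qK, _, HK, T, PK, σK, Y₀K, hsm, hT, hint, hGEN => by
    classical
    haveI : IsLocallyNoetherian X := LocallyOfFiniteType.isLocallyNoetherian q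
    haveI := hint
    haveI : Flat jK := flat_of_isPullback_generic K q HK
    haveI : IsProper (blowup.π C) := (blowup.isBlowup C).isProper
    haveI : IsLocallyNoetherian (blowup C) := LocallyOfFiniteType.isLocallyNoetherian (blowup.π C)
    haveI : IsProper (blowup.π (C.comap jK)) := (blowup.isBlowup (C.comap jK)).isProper
    haveI : IsLocallyNoetherian (blowup (C.comap jK)) := LocallyOfFiniteType.isLocallyNoetherian (blowup.π (C.comap jK))
    -- the generic fibre of the blown-up stage
    set g : blowup (C.comap jK) ⟶ blowup C := blowup.comapMap C jK with hg
    haveI : Flat g := blowup.comapMap_mem @Flat C jK inferInstance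
    have hsqK : g ≫ blowup.π C = blowup.π (C.comap jK) ≫ jK := blowup.comapMap_π C jK
    have HK₁ : IsPullback g (blowup.π (C.comap jK) ≫ qK) (blowup.π C ≫ q) (specOfAlgebra A K) :=
      (blowup.isPullback_comapMap C jK).paste_vert HK
    haveI : LocallyOfFiniteType (blowup.π C ≫ q) := inferInstance
    haveI : QuasiCompact (blowup.π C ≫ q) := inferInstance
    haveI : LocallyOfFiniteType (blowup.π (C.comap jK) ≫ qK) := inferInstance
    -- the next running ideal and its generic fibre
    set T' : (blowup C).IdealSheafData := strictTransformIdeal (blowup.π C) C T with hT'def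
    have hT'K : T'.comap g = strictTransformIdeal (blowup.π (C.comap jK)) (C.comap jK) (T.comap jK) :=
      comap_strictTransformIdeal_of_flat jK hsqK C T
    have hYK' : (((T'.comap g).support : Set (blowup (C.comap jK)))) =
        closure (blowup.π (C.comap jK) ⁻¹' ((((T.comap jK).support : Set XK)) \ ((C.comap jK).support : Set XK))) := by
      rw [hT'K]; exact support_strictTransformIdeal_eq_closure _ _ _
    -- the K-side data at this stage
    rw [CentreSeq.comap_cons] at hsm hT
    haveI : Smooth ((C.comap jK).subschemeι ≫ qK) := hsm.1
    obtain ⟨hE1K, hposK, hrestK⟩ := hT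
    have hYirr : IsIrreducible (((T.comap jK).support : Set XK)) := isIrreducible_support_of_isIntegral (T.comap jK)
    have hleK : T.comap jK ≤ C.comap jK := le_of_support_subset_of_smooth (T.comap jK) (C.comap jK) qK hE1K
    have hns : ¬ (((T.comap jK).support : Set XK)) ⊆ (C.comap jK).support :=
      not_subset_support_of_gen σK Y₀K _ (C.comap jK) hYirr (T.comap jK).support.isClosed hGEN hposK
    have hint' : IsIntegral (T'.comap g).subscheme := by
      rw [hT'K]
      exact isIntegral_subscheme_strictTransformIdeal (blowup.isBlowup (C.comap jK)) (T.comap jK) hns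
    have hGEN' : ∀ y, IsGenericPoint y (((T'.comap g).support : Set (blowup (C.comap jK)))) →
        IsGenericPoint ((blowup.π (C.comap jK) ≫ σK) y) Y₀K := by
      rw [hYK']
      exact gen_closure_preimage_diff_of_isBlowup hYirr (T.comap jK).support.isClosed (C.comap jK) (blowup.isBlowup (C.comap jK)) hGEN hns
    have hrestK' : DescTransformOK (rest.comap g) (blowup.π (C.comap jK) ≫ σK) Y₀K (((T'.comap g).support : Set _)) := by
      rw [hYK']; exact hrestK
    -- (2) spread `𝓣 ≤ C`; (3) spread the flatness of the trace `E ∩ V(𝓣')`; (4) the tail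
    obtain ⟨a₂, ha₂, h₂⟩ := exists_forall_comap_le_comap K q HK T C hleK
    obtain ⟨a₃, ha₃, h₃⟩ := exists_forall_flat_trace_comap (blowup.π C ≫ q) T' (C.comap (blowup.π C))
    obtain ⟨a₄, ha₄, h₄⟩ := CentreSeq.exists_forall_descTransformOK_comap rest (blowup.π C ≫ q) g (blowup.π (C.comap jK) ≫ qK) HK₁ T'
      (blowup.π (C.comap jK) ≫ σK) Y₀K hsm.2 hrestK' hint' hGEN'
    refine ⟨a₂ * a₃ * a₄, mul_ne_zero (mul_ne_zero ha₂ ha₃) ha₄, fun B _ _ _ _ hunit XB ιB qB HX hEF k _ _ Xk j tk HXk Pk σk => ?_⟩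
    rw [map_mul, map_mul] at hunit
    have hu₂ : IsUnit (algebraMap A B a₂) := isUnit_of_mul_isUnit_left (isUnit_of_mul_isUnit_left hunit)
    have hu₃ : IsUnit (algebraMap A B a₃) := isUnit_of_mul_isUnit_right (isUnit_of_mul_isUnit_left hunit)
    have hu₄ : IsUnit (algebraMap A B a₄) := isUnit_of_mul_isUnit_right hunit
    -- the B-side stage: flat `ι_B`, locally Noetherian `X_B`, the blown-up square
    haveI : Flat (specOfAlgebra A B) := by
      rw [Flat.SpecMap_iff, CommRingCat.hom_ofHom]
      exact RingHom.flat_algebraMap_iff.mpr inferInstance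
    haveI : Flat ιB := MorphismProperty.of_isPullback HX.flip ‹Flat (specOfAlgebra A B)›
    haveI : LocallyOfFiniteType qB := MorphismProperty.of_isPullback HX (inferInstance : LocallyOfFiniteType q)
    haveI : IsLocallyNoetherian XB := LocallyOfFiniteType.isLocallyNoetherian qB
    haveI : IsProper (blowup.π (C.comap ιB)) := (blowup.isBlowup (C.comap ιB)).isProper
    haveI : IsLocallyNoetherian (blowup (C.comap ιB)) := LocallyOfFiniteType.isLocallyNoetherian (blowup.π (C.comap ιB))
    set ιB' : blowup (C.comap ιB) ⟶ blowup C := blowup.comapMap C ιB with hιB'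
    haveI : Flat ιB' := blowup.comapMap_mem @Flat C ιB inferInstance
    have hsqB : ιB' ≫ blowup.π C = blowup.π (C.comap ιB) ≫ ιB := blowup.comapMap_π C ιB
    have H1 : IsPullback ιB' (blowup.π (C.comap ιB) ≫ qB) (blowup.π C ≫ q) (specOfAlgebra A B) :=
      (blowup.isPullback_comapMap C ιB).paste_vert HX
    -- the fibre stage: locally Noetherian, and the blown-up fibre square (B-flat exceptional divisor)
    haveI : LocallyOfFiniteType tk := MorphismProperty.of_isPullback HXk (inferInstance : LocallyOfFiniteType qB)
    haveI : IsLocallyNoetherian Xk := LocallyOfFiniteType.isLocallyNoetherian tk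
    haveI : IsProper (blowup.π ((C.comap ιB).comap j)) := (blowup.isBlowup _).isProper
    haveI : IsLocallyNoetherian (blowup ((C.comap ιB).comap j)) := LocallyOfFiniteType.isLocallyNoetherian (blowup.π ((C.comap ιB).comap j))
    rw [CentreSeq.comap_cons] at hEF
    haveI : Flat ((((C.comap ιB).comap (blowup.π (C.comap ιB)))).subschemeι ≫ blowup.π (C.comap ιB) ≫ qB) := hEF.1
    set j' : blowup ((C.comap ιB).comap j) ⟶ blowup (C.comap ιB) := blowup.comapMap (C.comap ιB) j with hj'
    have hsqk : j' ≫ blowup.π (C.comap ιB) = blowup.π ((C.comap ιB).comap j) ≫ j := blowup.comapMap_π _ _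
    have HXk₁ : IsPullback j' (blowup.π ((C.comap ιB).comap j) ≫ tk) (blowup.π (C.comap ιB) ≫ qB) (specOfAlgebra B k) :=
      blowup.isPullback_comapMap_specMap_of_flat_exceptional k qB (C.comap ιB) HXk
    -- the B-side running ideals: `𝓣' · 𝒪 = strictTransformIdeal π_B C_B 𝓣_B` (flat base change) and the trace is flat
    have e2 : T'.comap ιB' = strictTransformIdeal (blowup.π (C.comap ιB)) (C.comap ιB) (T.comap ιB) :=
      comap_strictTransformIdeal_of_flat ιB hsqB C T
    have e1 : (C.comap (blowup.π C)).comap ιB' = (C.comap ιB).comap (blowup.π (C.comap ιB)) :=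
      (comap_exceptional_eq_comap_comapMap C ιB).symm
    have hflat := h₃ B hu₃ ιB' (blowup.π (C.comap ιB) ≫ qB) H1
    rw [e1, e2] at hflat
    haveI := hflat
    -- the goal, clause by clause
    rw [CentreSeq.comap_cons, CentreSeq.comap_cons]
    refine ⟨descTransformOK_E1_of_le j (h₂ B hu₂ ιB qB HX) _ rfl, image_subset_not_isGenericPoint_empty _ _, ?_⟩
    -- the tail: the induction hypothesis, read on the fibre of the B-side strict transform
    have key := h₄ B hu₄ ιB' (blowup.π (C.comap ιB) ≫ qB) H1 hEF.2 k j' (blowup.π ((C.comap ιB).comap j) ≫ tk) HXk₁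
      (blowup.π ((C.comap ιB).comap j) ≫ σk)
    rw [e2, support_comap_strictTransformIdeal_of_flat_trace k j hsqk (blowup.π (C.comap ιB) ≫ qB) HXk₁ (C.comap ιB) (T.comap ιB)
      (blowup.isBlowup (C.comap ιB)).isEffectiveCartier] at key
    exact key

end FibreWord

end Summit.ResolutionOfSingularities.ResolutionOfSingularities.Cruxes.EquisingularLiftNat.Sections

end
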